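import Summits.QuantumFields.BalabanUV.Beta.GAN24.DerivativeRateTransferAnalyticMixed
import HarnessLib

/-!
# «TOP CONVERSION» ENGINE, BY KERNEL: real four-point smallness `σ` + holomorphy with ONE bound `B` on the bidisc ⟹ the MIXED DERIVATIVE
# at the base point is `≲ σ^{(1−r)(1−r′)}` — two constants at the tip of a slit, TWICE, over the tree's engine BY NAME

Cell `ym3-torus` (YM ladder rung R3 = continuum `SU(2)` Yang–Mills on the three-torus — a RUNG, NOT d = 4, NOT infinite volume, NOT a mass
gap, NOT Clay).  LEAD-20520 width seat `ym-ust-20520-w3` (gen 24); `--supports stmt-QuantumFields-20520 --as helper`, count-neutral,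
definition-free, default heartbeats; no registry, binder or `Lines/` edit (registered skeleton `Lines/semiclassical_s2beta.lean` v11.4, 0∕5,
★★OWNER RULING №36, untouched).

WHAT THIS IS.  The v18 design of the organ (O1ᵘ-H, ideator `ym-r3-idea-1` g26, `CURRENCY-MEMO-g26.md` §9 TN-SB ∕ §10; critic #555∕#561∕#568;
LEAD-20520 №15 «price of (β) = 1 D-item + 1 displayed L-debt (S1ᴴ analyticity) + 1 M (`TopConversion` by Cauchy estimates on the polydisc) +
junction S + re-keys»; ★★OWNER RULINGS №58∕№60∕№61∕№64) needs, at the SEED height, a conversion of the frozen seed's SIZE-BLIND smallness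
(`|ΔΔR| ≤ σ` for REAL one-bond moves) plus print's ANALYTICITY of the densities on the complexified window ([Balaban1985UV3] p.263 (c),
carried by the predicate `AnalyticPairWindowAt θ r B f` of the HOME draft `O1uH_draft.lean`: a `g : ℂ × ℂ → ℂ` holomorphic on
`ball 0 (rθ) ×ˢ ball 0 (rθ)`, bounded, agreeing with the two-parameter real move function) into HESSIAN-currency letters whose SIZE is a
power of `σ` — the memo's «exponent α = harmonic measure of the real segment in the bidisc».  The two-constants estimate at the TIP OF A SLIT
is IN THE TREE (`BalabanUV.Beta.RemainderExplicitMarkovRate`, Joukowski chart + Hadamard three lines + Cauchy; `GAN24.DerivativeRateTransferAnalytic.transferω`;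
two variables: `GAN24.DerivativeRateTransferAnalyticMixed.derivMixed_step_rateω`, Osgood BY NAME).  This file is the organ-shaped COROLLARY:

* §1 `differentiableOn_separated` ∕ `norm_separated_le` — the «separated part» `(s,t) ↦ g(s,0) + g(0,t) − g(0,0)` is holomorphic on the bidisc,
  bounded by `3B`, and has ZERO mixed derivative at the base point (`derivMixed_separated_eq_zero`: its `s`-derivative at `0` does not depend on `t`).
* §2 ★★`norm_derivMixed_le_of_realFourPoint` — `g : ℂ × ℂ → ℂ` holomorphic on `ball 0 ρ ×ˢ ball 0 ρ` with `‖g‖ ≤ B` (`0 < B`), `0 < s₁`,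
  `s₁·cosh 1 < ρ`, and REAL four-point smallness on the square based at the origin
  `∀ s t ∈ [0, s₁], ‖g(s,t) − g(s,0) − g(0,t) + g(0,0)‖ ≤ σ` (`0 < σ`): for all `r, r′ ∈ ]0, 1]`,
  `‖∂_t ∂_s g (0,0)‖ ≤ 25·(2·(4·(3B)∕ρ))^{r′}∕(s₁r′²) · (25·(2·(3B))^{r}∕(s₁r²) · σ^{1−r})^{1−r′}`
  — `derivMixed_step_rateω` on the two-term family `F 0 := separated part`, `F (k+1) := g` (value rate `σ·(1∕2)^k` on the real square:
  the `k = 0` step IS the four-point hypothesis, later steps vanish), minus §1's zero.  The exponent of `σ` is `(1−r)(1−r′)`, any `r, r′ ∈ ]0,1]`: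
  «ratio up to a power loss as small as one pays for in the constant» — the harmonic-measure law at the tip of the slit, squared.
* §3 `norm_derivMixed_le_of_realFourPoint_sq` — the symmetric choice `r = r′`, and `…_half` — the numeric instance `r = r′ = 1∕2` (exponent `1∕4`).

WHAT THIS BUYS.  With the D-item (β) stated as in the draft (`g` holomorphic with ONE bound on the bidisc of radius `r·θ`, real traces = the
organ's two-parameter move function) and the seed's size-blind clause (REAL moves), the HESSIAN ENTRY of the discrepancy at every window base point
is `≤ C(B, r, θ)·σ_K^{(1−r)(1−r′)}` — the infinitesimal form of TopConversion; the finite-difference H-clause letters follow by integrating the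
Hessian entries over the real move rectangle (base-point translation keeps every hypothesis; next file).  Complement: ✓`…OrganTangentBidiscMixedDifference`
(this seat, same night) gives the `σ`-free letters `8B∕r²` from `B` alone.  WHAT THIS IS NOT: nothing of Bałaban's (that the runs' densities are
analytic on the complex window with a usable `B` is print's claim, [Balaban1985UV3] p.263, not formalised; the seed's `σ_K` is the frozen
`RunPairSeed`'s letter, a HYPOTHESIS); O1∕O1ᵘ-H∕S2ᴴ∕S3ᴴ, the five registered ∘-stubs, crux 20520 `FluctuationComparisonRegPrIntL`, `YM3TorusSU2`
NOT proved; no summit is proved by a helper.  R3 = SU(2) YM₃ on T³ — NOT d = 4, NOT infinite volume, NOT a mass gap, NOT Clay; the Yang–Mills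
mass gap is NOT proved.
-/

noncomputable section

open Metric Set Complex
open Summit.QuantumFields.BalabanUV.Beta.GAN24.DerivativeRateTransferAnalytic (rho_pos)
open Summit.QuantumFields.BalabanUV.Beta.GAN24.DerivativeRateTransferAnalyticMixed
  (differentiableOn_slice_fst differentiableOn_slice_snd derivMixed_step_rateω)

namespace Summit.QuantumFields.YangMills.Theorems.OrganTangentTwoConstantsMixed

variable {g : ℂ × ℂ → ℂ} {ρ B : ℝ}

/-! ## §1 The separated part `g(s,0) + g(0,t) − g(0,0)` -/

/-- The separated part is holomorphic on the bidisc. [folklore] -/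
theorem differentiableOn_separated (hρ : 0 < ρ) (hg : DifferentiableOn ℂ g (ball (0 : ℂ) ρ ×ˢ ball (0 : ℂ) ρ)) :
    DifferentiableOn ℂ (fun p : ℂ × ℂ => g (p.1, 0) + g (0, p.2) - g (0, 0)) (ball (0 : ℂ) ρ ×ˢ ball (0 : ℂ) ρ) := by
  have h0 : (0 : ℂ) ∈ ball (0 : ℂ) ρ := mem_ball_self hρ
  have h1 : DifferentiableOn ℂ (fun p : ℂ × ℂ => g (p.1, 0)) (ball (0 : ℂ) ρ ×ˢ ball (0 : ℂ) ρ) :=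
    (differentiableOn_slice_fst hg h0).comp differentiableOn_fst fun p hp => hp.1
  have h2 : DifferentiableOn ℂ (fun p : ℂ × ℂ => g (0, p.2)) (ball (0 : ℂ) ρ ×ˢ ball (0 : ℂ) ρ) :=
    (differentiableOn_slice_snd hg h0).comp differentiableOn_snd fun p hp => hp.2
  exact (h1.add h2).sub (differentiableOn_const _)

/-- The separated part is bounded by `3B` on the bidisc. [folklore] -/
theorem norm_separated_le (hρ : 0 < ρ) (hB : ∀ p ∈ ball (0 : ℂ) ρ ×ˢ ball (0 : ℂ) ρ, ‖g p‖ ≤ B)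
    {p : ℂ × ℂ} (hp : p ∈ ball (0 : ℂ) ρ ×ˢ ball (0 : ℂ) ρ) :
    ‖g (p.1, 0) + g (0, p.2) - g (0, 0)‖ ≤ 3 * B := by
  have h0 : (0 : ℂ) ∈ ball (0 : ℂ) ρ := mem_ball_self hρ
  have e1 := hB (p.1, 0) ⟨hp.1, h0⟩
  have e2 := hB (0, p.2) ⟨h0, hp.2⟩
  have e3 := hB (0, 0) ⟨h0, h0⟩
  calc ‖g (p.1, 0) + g (0, p.2) - g (0, 0)‖ ≤ ‖g (p.1, 0) + g (0, p.2)‖ + ‖g (0, 0)‖ := norm_sub_le _ _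
    _ ≤ (‖g (p.1, 0)‖ + ‖g (0, p.2)‖) + ‖g (0, 0)‖ := by gcongr; exact norm_add_le _ _
    _ ≤ (B + B) + B := by gcongr
    _ = 3 * B := by ring

/-- The `s`-derivative at `0` of the separated part does not depend on `t`. [folklore] -/
theorem deriv_fst_separated (t : ℂ) :
    deriv (fun s : ℂ => g (s, 0) + g (0, t) - g (0, 0)) 0 = deriv (fun s : ℂ => g (s, 0)) 0 := by
  have : (fun s : ℂ => g (s, 0) + g (0, t) - g (0, 0)) = fun s : ℂ => g (s, 0) + (g (0, t) - g (0, 0)) := by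
    funext s; ring
  rw [this, deriv_add_const]

/-- ★ The separated part has ZERO mixed derivative at the base point. [folklore] -/
theorem derivMixed_separated_eq_zero :
    deriv (fun t : ℂ => deriv (fun s : ℂ => g (s, 0) + g (0, t) - g (0, 0)) 0) 0 = 0 := by
  have : (fun t : ℂ => deriv (fun s : ℂ => g (s, 0) + g (0, t) - g (0, 0)) 0) = fun _ : ℂ => deriv (fun s : ℂ => g (s, 0)) 0 := by
    funext t; exact deriv_fst_separated t
  rw [this, deriv_const]

/-! ## §2 The mixed derivative at the base point inherits the real four-point smallness -/

/-- ★★ **TOP CONVERSION, INFINITESIMAL FORM.**  `g : ℂ × ℂ → ℂ` holomorphic on the bidisc `ball 0 ρ ×ˢ ball 0 ρ` with `‖g‖ ≤ B` (`0 < B`);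
`0 < s₁`, `s₁·cosh 1 < ρ`; REAL four-point smallness on the square based at the origin: `‖g(s,t) − g(s,0) − g(0,t) + g(0,0)‖ ≤ σ` for
`s, t ∈ [0, s₁]` (`0 < σ`).  Then for all `r, r′ ∈ ]0, 1]` the mixed derivative at the base point obeys
`‖∂_t∂_s g(0,0)‖ ≤ 25·(2·(4·(3B)∕ρ))^{r′}∕(s₁r′²) · (25·(2·(3B))^{r}∕(s₁r²)·σ^{1−r})^{1−r′}` — two constants at the tip of a slit in `s` at each
real `t`, then again in `t` on the holomorphic family `t ↦ ∂_s(·)(0,t)` (the tree's ✓`derivMixed_step_rateω`, applied to the two-term family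
«separated part, g, g, …» with value rate `σ·(1∕2)^k`), minus the separated part's zero. [folklore] -/
theorem norm_derivMixed_le_of_realFourPoint {s₁ σ : ℝ} (hs₁ : 0 < s₁) (hs₁ρ : s₁ * Real.cosh 1 < ρ)
    (hg : DifferentiableOn ℂ g (ball (0 : ℂ) ρ ×ˢ ball (0 : ℂ) ρ))
    (hB : ∀ p ∈ ball (0 : ℂ) ρ ×ˢ ball (0 : ℂ) ρ, ‖g p‖ ≤ B) (hB0 : 0 < B)
    (hσ : ∀ s t : ℝ, 0 ≤ s → s ≤ s₁ → 0 ≤ t → t ≤ s₁ →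
      ‖g ((s : ℂ), (t : ℂ)) - g ((s : ℂ), 0) - g (0, (t : ℂ)) + g (0, 0)‖ ≤ σ) (hσ0 : 0 < σ)
    {r r' : ℝ} (hr : 0 < r) (hr1 : r ≤ 1) (hr' : 0 < r') (hr'1 : r' ≤ 1) :
    ‖deriv (fun t : ℂ => deriv (fun s : ℂ => g (s, t)) 0) 0‖ ≤
      25 * (2 * (4 * (3 * B) / ρ)) ^ r' / (s₁ * r' ^ 2) * (25 * (2 * (3 * B)) ^ r / (s₁ * r ^ 2) * σ ^ (1 - r)) ^ (1 - r') := by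
  have hρ : 0 < ρ := rho_pos hs₁ hs₁ρ
  -- the two-term family: F 0 = separated part, F (k+1) = g
  let F : ℕ → ℂ × ℂ → ℂ := fun k p => if k = 0 then g (p.1, 0) + g (0, p.2) - g (0, 0) else g p
  have hF0 : F 0 = fun p : ℂ × ℂ => g (p.1, 0) + g (0, p.2) - g (0, 0) := by
    funext p; simp [F]
  have hFs : ∀ k : ℕ, F (k + 1) = g := by
    intro k; funext p; simp [F]
  have hFd : ∀ k, DifferentiableOn ℂ (F k) (ball (0 : ℂ) ρ ×ˢ ball (0 : ℂ) ρ) := by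
    intro k
    rcases k with _ | k
    · rw [hF0]; exact differentiableOn_separated hρ hg
    · rw [hFs k]; exact hg
  have hB3 : B ≤ 3 * B := by linarith
  have hFB : ∀ k, ∀ p ∈ ball (0 : ℂ) ρ ×ˢ ball (0 : ℂ) ρ, ‖F k p‖ ≤ 3 * B := by
    intro k p hp
    rcases k with _ | k
    · rw [hF0]; exact norm_separated_le hρ hB hp
    · rw [hFs k]; exact (hB p hp).trans hB3
  have hrate : ∀ k (s t : ℝ), 0 ≤ s → s ≤ s₁ → 0 ≤ t → t ≤ s₁ →
      ‖F (k + 1) ((s : ℂ), (t : ℂ)) - F k ((s : ℂ), (t : ℂ))‖ ≤ σ * (1 / 2 : ℝ) ^ k := by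
    intro k s t hs0 hs1 ht0 ht1
    rcases k with _ | k
    · rw [hFs 0, hF0, pow_zero, mul_one]
      have : g ((s : ℂ), (t : ℂ)) - (g (((s : ℂ), (t : ℂ)).1, 0) + g (0, ((s : ℂ), (t : ℂ)).2) - g (0, 0)) =
          g ((s : ℂ), (t : ℂ)) - g ((s : ℂ), 0) - g (0, (t : ℂ)) + g (0, 0) := by ring
      rw [this]
      exact hσ s t hs0 hs1 ht0 ht1
    · rw [hFs (k + 1), hFs k, sub_self, norm_zero]
      positivity
  have key := derivMixed_step_rateω (F := F) (B := 3 * B) (c := σ) (θ := (1 / 2 : ℝ)) hs₁ hs₁ρ hFd hFB (by linarith) hrate hσ0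
    (by norm_num) hr hr1 hr' hr'1 0
  rw [pow_zero, mul_one, hFs 0, hF0] at key
  have hz : deriv (fun t : ℂ => deriv (fun s : ℂ => g (((s, t) : ℂ × ℂ).1, 0) + g (0, ((s, t) : ℂ × ℂ).2) - g (0, 0)) 0) 0 = 0 :=
    derivMixed_separated_eq_zero
  rw [hz, sub_zero] at key
  exact key

/-! ## §3 Symmetric and numeric instances -/

/-- The symmetric choice `r = r′`: exponent `(1 − r)²` on `σ`-side inner constant. [folklore] -/
theorem norm_derivMixed_le_of_realFourPoint_sq {s₁ σ : ℝ} (hs₁ : 0 < s₁) (hs₁ρ : s₁ * Real.cosh 1 < ρ)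
    (hg : DifferentiableOn ℂ g (ball (0 : ℂ) ρ ×ˢ ball (0 : ℂ) ρ))
    (hB : ∀ p ∈ ball (0 : ℂ) ρ ×ˢ ball (0 : ℂ) ρ, ‖g p‖ ≤ B) (hB0 : 0 < B)
    (hσ : ∀ s t : ℝ, 0 ≤ s → s ≤ s₁ → 0 ≤ t → t ≤ s₁ →
      ‖g ((s : ℂ), (t : ℂ)) - g ((s : ℂ), 0) - g (0, (t : ℂ)) + g (0, 0)‖ ≤ σ) (hσ0 : 0 < σ)
    {r : ℝ} (hr : 0 < r) (hr1 : r ≤ 1) :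
    ‖deriv (fun t : ℂ => deriv (fun s : ℂ => g (s, t)) 0) 0‖ ≤
      25 * (2 * (4 * (3 * B) / ρ)) ^ r / (s₁ * r ^ 2) * (25 * (2 * (3 * B)) ^ r / (s₁ * r ^ 2) * σ ^ (1 - r)) ^ (1 - r) :=
  norm_derivMixed_le_of_realFourPoint hs₁ hs₁ρ hg hB hB0 hσ hσ0 hr hr1 hr hr1

/-- ★ The numeric instance `r = r′ = 1∕2`: `‖∂_t∂_s g(0,0)‖ ≤ 25·(24B∕ρ)^{1∕2}∕(s₁∕4) · (25·(6B)^{1∕2}∕(s₁∕4)·σ^{1∕2})^{1∕2}` — the mixed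
derivative is `O(σ^{1∕4})` with constants polynomial in `B`, `1∕s₁`, `1∕ρ`. [folklore] -/
theorem norm_derivMixed_le_of_realFourPoint_half {s₁ σ : ℝ} (hs₁ : 0 < s₁) (hs₁ρ : s₁ * Real.cosh 1 < ρ)
    (hg : DifferentiableOn ℂ g (ball (0 : ℂ) ρ ×ˢ ball (0 : ℂ) ρ))
    (hB : ∀ p ∈ ball (0 : ℂ) ρ ×ˢ ball (0 : ℂ) ρ, ‖g p‖ ≤ B) (hB0 : 0 < B)
    (hσ : ∀ s t : ℝ, 0 ≤ s → s ≤ s₁ → 0 ≤ t → t ≤ s₁ →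
      ‖g ((s : ℂ), (t : ℂ)) - g ((s : ℂ), 0) - g (0, (t : ℂ)) + g (0, 0)‖ ≤ σ) (hσ0 : 0 < σ) :
    ‖deriv (fun t : ℂ => deriv (fun s : ℂ => g (s, t)) 0) 0‖ ≤
      25 * (2 * (4 * (3 * B) / ρ)) ^ (1 / 2 : ℝ) / (s₁ * (1 / 2 : ℝ) ^ 2) *
        (25 * (2 * (3 * B)) ^ (1 / 2 : ℝ) / (s₁ * (1 / 2 : ℝ) ^ 2) * σ ^ (1 - 1 / 2 : ℝ)) ^ (1 - 1 / 2 : ℝ) :=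
  norm_derivMixed_le_of_realFourPoint hs₁ hs₁ρ hg hB hB0 hσ hσ0 (by norm_num) (by norm_num) (by norm_num) (by norm_num)

end Summit.QuantumFields.YangMills.Theorems.OrganTangentTwoConstantsMixed

end
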